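import Summits.Ventures.YMGap.Conjectures.StrongCouplingSUNChiralLROMesonWeightRP
import Summits.Ventures.YMGap.Conjectures.StrongCouplingSUNChiralLROMesonWeightSymmetry
import Summits.Ventures.YMGap.Conjectures.StrongCouplingChiralLROMesonWeightInfraredBoundN
import Literature.MathematicalPhysics.StatisticalMechanics.ComplexSpinFluctuationFiveSixCertificate
import HarnessLib
import HarnessLib.Audit.Tags

/-!
# Chiral long-range order at `β = 0` for `SU(N)` lattice gauge theory, `N` odd `≥ 3`, one massless
# staggered fermion, every dimension `ν ≥ 4`

Cell `pub-ymgap`, seat qcd-lit g26 (literature-prover), `bears_on: Q1` (the `SU(N)` extension that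
Salmhofer–Seiler §5 p. 424 call «generally believed»: «The case of SU(N) is technically more complicated
… baryon loops … it is generally believed that these additional terms do not qualitatively change the
behaviour»).  Everything is a theorem (0 facts, 0 sorry).

* EVERY PLANE, given the lattice symmetries (`isRPWeight_bgWeightNSU`), and **`infraredBound_SU`**:
  `2(ν ∓ C(χ))(±T̂(χ)) ≤ 4N` at every character, uniformly in `L` — Salmhofer–Seiler's (3.112)–(3.113) for
  the `β = 0` `SU(N)` kernel `T(x,y) = ⟨ψ̄ψ(x)ψ̄ψ(y)⟩_Λ`, by Gaussian domination for the meson weight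
  (`ComplexSpinRPWeightInfraredBound`); the symmetries are those of `…SUNChiralLROMesonWeightSymmetry`.
* THE SCHWINGER–DYSON BOUND in kernel form (`sum_suTwoPoint_nbr_ge`, `b = 4N`, from the tree's
  `sum_nbr_fermiExpectSU_ge_torus`), translation invariance and the chiral grading of `T`.
* **`chiralLRO_SU`**, **`chiralLRO_SU_three`**: for `N` odd `≥ 3` and `ν ≥ 4` there are `c > 0`, `L₀` with
  `|Λ|⁻¹∑_x T(0,x) ≥ c` for all even `L ≥ L₀` — by `kernel_chiralLRO_uniform` with `2·4N·S(ν) < 4N`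
  (`S(ν) < 7/20 < 1/2`, `fluctS_lt_of_four_le`).

Honest framing: `β = 0` only (the Schwinger–Dyson side at `β > 0` for `SU(N)` is open mathematics); finite
volume uniformly in `L`; false for `SU(2)`; nothing about the thermodynamic or continuum limit, several
flavours, or the summit's `QCD` conjunct.

## References
* [SalmhoferSeiler1991] M. Salmhofer, E. Seiler, Commun. Math. Phys. 139 (1991) 395–432, Thm. 3.21
  (3.112)–(3.113), (3.100)–(3.106), Lemma 4.7 (4.38), Thm. 4.8, Cor. 4.9 (4.41)–(4.42), Remark 4.5, §5 p. 424.
* [FrommForcrand2008] M. Fromm, Ph. de Forcrand, arXiv:0811.1931, (4)–(7).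
-/

noncomputable section

open MeasureTheory Finset MvPolynomial
open scoped ComplexConjugate BigOperators ComplexOrder
open Literature.MathematicalPhysics.QuantumFieldTheory (Site Edge GaugeConfig Site.timeReflect)
open Literature.MathematicalPhysics.QuantumFieldTheory.WilsonRP
open Literature.MathematicalPhysics.QuantumLattice
open Literature.MathematicalPhysics.QuantumLattice.GrassmannAlgebra
open Literature.MathematicalPhysics.QuantumLattice.StrongCoupling
open Literature.MathematicalPhysics.QuantumLattice.StaggeredRP (thetaT posAlg posSites IsPosSite
  gaussCorrN gaussTermN HermSqCert)
open Literature.MathematicalPhysics.StatisticalMechanics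
open Literature.MathematicalPhysics.StatisticalMechanics.ComplexSpin
open Literature.Barriers.CriticalPhenomena.NonGibbs
open Literature.Probability.LatticeModels (TorusSite)


namespace Summit.Ventures.YMGap.Conjectures

namespace MesonWeightSU

open MesonWeight

variable {N ν L : ℕ} [NeZero ν] [NeZero L] [LinearOrder (TorusSite ν L)]

/-! ### Every plane, given the lattice symmetries; the infrared bound; long-range order -/

/-- **The background weight is a reflection-positive weight for EVERY plane of the even torus, both
twists**, given the invariance of the meson moments under lattice translations (`hT`) and axis
transpositions (`hP`). [cite: SalmhoferSeiler1991, Remark 4.5 and (3.90)–(3.93)] -/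
theorem isRPWeight_bgWeightNSU (hN : Odd N) (h1 : 1 < N) (hL : Even L)
    (hT : ∀ (c : TorusSite ν L) (m : TorusSite ν L →₀ ℕ),
      mesonMomentSU N ν L (Finsupp.mapDomain (Equiv.addRight c) m) = mesonMomentSU N ν L m)
    (hP : ∀ (i : Fin ν) (m : TorusSite ν L →₀ ℕ),
      mesonMomentSU N ν L (Finsupp.mapDomain (axisSwap i) m) = mesonMomentSU N ν L m)
    (ε : ℤ) (i : Fin ν) (k : ZMod L) : IsRPWeight i k N (bgWeightNSU N ν L ε) := by
  refine isRPWeight_of_conj i k (planeConj i k) (siteReflect_planeConj i k) (planeConj_mem_halfPlus i k)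
    ?_ ?_ ?_ (isRPWeight_bgWeightNSU_zero_one hN h1 hL ε)
  · rw [bgWeightNSU, map_mul, map_mul, map_conj_mesonWeightCSU hN hL, map_conj_siteFactorN, map_conj_bondFactorN]
  · rw [bgWeightNSU, map_mul, map_mul, rename_bondFactorN_planeConj, rename_siteFactorN,
      rename_mesonWeightCSU (planeConj i k) fun m => by
        rw [planeConj, Equiv.coe_trans, Finsupp.mapDomain_comp, hT, hP]]
  · rw [bgWeightNSU, map_mul, map_mul, rename_siteReflect_mesonWeightCSU hN h1 hL, rename_siteReflect_siteFactorN hL,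
      rename_siteReflect_bondFactorN hL]

/-- Translation invariance of the kernel `[σ_xσ_y]_W` from that of the moments. [cite: SalmhoferSeiler1991, (3.100)] -/
theorem twoPtWR_mesonWeightSU_add (hN : Odd N) (hL : Even L)
    (hT : ∀ (c : TorusSite ν L) (m : TorusSite ν L →₀ ℕ),
      mesonMomentSU N ν L (Finsupp.mapDomain (Equiv.addRight c) m) = mesonMomentSU N ν L m)
    (x y c : TorusSite ν L) :
    twoPtWR N (mesonWeightSU N ν L) (x + c) (y + c) = twoPtWR N (mesonWeightSU N ν L) x y := by
  apply Complex.ofReal_injective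
  rw [twoPtWR, twoPtWR, ← bracketW_map_map, ← bracketW_map_map, map_mesonWeightSU hN hL, map_mul, map_mul,
    map_X, map_X, map_X, map_X,
    show (X (x + c) * X (y + c) : FieldAlg ν L) =
        monomial (Finsupp.mapDomain (Equiv.addRight c) (Finsupp.single x 1 + Finsupp.single y 1)) 1 by
      rw [Finsupp.mapDomain_add, Finsupp.mapDomain_single, Finsupp.mapDomain_single, Equiv.coe_addRight,
        X, X, monomial_mul, mul_one],
    show (X x * X y : FieldAlg ν L) = monomial (Finsupp.single x 1 + Finsupp.single y 1) 1 by
      rw [X, X, monomial_mul, mul_one],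
    bracketW_mesonWeightCSU_monomial hL, bracketW_mesonWeightCSU_monomial hL, hT]

/-- **(IR)_{0,4N} FOR THE `β = 0` `SU(N)` THEORY (`N` odd `≥ 3`, all-antiperiodic even torus), UNIFORMLY IN
THE VOLUME**, given the lattice symmetries of the meson moments: `2(ν ∓ C(χ))(±T̂(χ)) ≤ 4N` at every
character. [cite: SalmhoferSeiler1991, Thm. 3.21 with (3.112)–(3.113), Remark 4.5 and §5 p. 424] -/
theorem infraredBound_SU (hN : Odd N) (h1 : 1 < N) (hL : Even L)
    (hT : ∀ (c : TorusSite ν L) (m : TorusSite ν L →₀ ℕ),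
      mesonMomentSU N ν L (Finsupp.mapDomain (Equiv.addRight c) m) = mesonMomentSU N ν L m)
    (hP : ∀ (i : Fin ν) (m : TorusSite ν L →₀ ℕ),
      mesonMomentSU N ν L (Finsupp.mapDomain (axisSwap i) m) = mesonMomentSU N ν L m)
    (χ : AddChar (TorusSite ν L) ℂ) :
    2 * ((ν : ℝ) - cosSum χ) * (kernelSymbol (fun x y => suTwoPoint N ν L x y) χ).re ≤ 4 * N ∧
      2 * ((ν : ℝ) + cosSum χ) * (-(kernelSymbol (fun x y => suTwoPoint N ν L x y) χ).re) ≤ 4 * N := by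
  have hN1 : 1 ≤ N := by omega
  have hL2 : 2 ≤ L := by obtain ⟨k, hk⟩ := hL; have := NeZero.ne L; omega
  have hcard : 2 ≤ Fintype.card (TorusSite ν L) := by
    rw [Fintype.card_fun, ZMod.card, Fintype.card_fin]
    calc 2 ≤ L := hL2
      _ ≤ L ^ ν := Nat.le_self_pow (NeZero.ne ν) L
  set W₀ := mesonWeightSU N ν L with hW₀
  have hW : ∀ (ε : ℤ) (i : Fin ν) (k : ZMod L), IsRPWeight i k N (bgWeightNSU N ν L ε) :=
    fun ε i k => isRPWeight_bgWeightNSU hN h1 hL hT hP ε i k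
  have hbg : ∀ ε : ℤ, TruncEq N (gaussFactor ε N * bgWeightNSU N ν L ε) (MvPolynomial.map Complex.ofRealHom W₀) := by
    intro ε
    rw [hW₀, map_mesonWeightSU hN hL]
    exact truncEq_gaussFactor_mul_bgWeightNSU hcard ε
  have hTinv : ∀ x y c : TorusSite ν L, twoPtWR N W₀ (x + c) (y + c) = twoPtWR N W₀ x y :=
    twoPtWR_mesonWeightSU_add hN hL hT
  have e1 := twoPtWR_mode_le hL (0 : Fin ν) hcard hN1 (hW 1) (hbg 1) hTinv χ
  have e2 := neg_twoPtWR_mode_le hL (0 : Fin ν) hcard hN1 (hW (-1)) (hbg (-1)) hTinv χ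
  set Z := bracketWR N W₀ 1 with hZdef
  have hZ : 0 < Z := bracketWR_mesonWeightSU_one_pos hN h1 hL
  have hNpos : (0 : ℝ) < N := by exact_mod_cast hN1
  have hker : (fun x y => suTwoPoint N ν L x y) = fun x y => ((2 * N : ℝ) ^ 2 / Z) * twoPtWR N W₀ x y := by
    funext x y
    rw [suTwoPoint_eq_twoPtWR_div hN h1 hL]
    ring
  have hsym : (kernelSymbol (fun x y => suTwoPoint N ν L x y) χ).re =
      ((2 * N : ℝ) ^ 2 / Z) * (kernelSymbol (twoPtWR N W₀) χ).re := by
    rw [hker, kernelSymbol_const_mul, Complex.re_ofReal_mul]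
  have hc : 0 < (2 * N : ℝ) ^ 2 / Z := by positivity
  have hkey : (2 * N : ℝ) ^ 2 / Z * (1 / N * Z) = 4 * N := by
    field_simp
    ring
  constructor
  · rw [hsym]
    calc 2 * ((ν : ℝ) - cosSum χ) * ((2 * N : ℝ) ^ 2 / Z * (kernelSymbol (twoPtWR N W₀) χ).re)
        = (2 * N : ℝ) ^ 2 / Z * (2 * ((ν : ℝ) - cosSum χ) * (kernelSymbol (twoPtWR N W₀) χ).re) := by ring
      _ ≤ (2 * N : ℝ) ^ 2 / Z * (1 / N * Z) := mul_le_mul_of_nonneg_left e1 hc.le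
      _ = 4 * N := hkey
  · rw [hsym]
    calc 2 * ((ν : ℝ) + cosSum χ) * -((2 * N : ℝ) ^ 2 / Z * (kernelSymbol (twoPtWR N W₀) χ).re)
        = (2 * N : ℝ) ^ 2 / Z * (2 * ((ν : ℝ) + cosSum χ) * -(kernelSymbol (twoPtWR N W₀) χ).re) := by ring
      _ ≤ (2 * N : ℝ) ^ 2 / Z * (1 / N * Z) := mul_le_mul_of_nonneg_left e2 hc.le
      _ = 4 * N := hkey


/-! ### The Schwinger–Dyson bound and the structure of the kernel -/

/-- **Translation invariance of the kernel**: `T(x + c, y + c) = T(x, y)`. [cite: SalmhoferSeiler1991, (3.100)] -/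
theorem suTwoPoint_add (hN : Odd N) (h1 : 1 < N) (hL : Even L) (x y c : TorusSite ν L) :
    suTwoPoint N ν L (x + c) (y + c) = suTwoPoint N ν L x y := by
  rw [suTwoPoint_eq_twoPtWR_div hN h1 hL, suTwoPoint_eq_twoPtWR_div hN h1 hL,
    twoPtWR_mesonWeightSU_add hN hL (fun c m => mesonMomentSU_mapDomain_addRight hN h1 hL c m)]

/-- **THE SCHWINGER–DYSON BOUND IN KERNEL FORM**: `∑_μ (T(0, e_μ) + T(0, −e_μ)) ≥ 4N` (`N` odd `≥ 3`,
`L` even `≥ 4`) — the tree's `sum_nbr_fermiExpectSU_ge_torus` (the links at `0` are `(0, e_μ)` and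
`(−e_μ, 0)`, and `T` is symmetric). [cite: SalmhoferSeiler1991, Lemma 4.7 (4.38) and §5 p. 424] [cite: FrommForcrand2008, (5)–(7)] -/
theorem sum_suTwoPoint_nbr_ge (hN : Odd N) (h3 : 3 ≤ N) (hL : Even L) (hL3 : 3 ≤ L) :
    4 * (N : ℝ) ≤ ∑ μ : Fin ν, (suTwoPoint N ν L 0 (Pi.single μ 1) + suTwoPoint N ν L 0 (-Pi.single μ 1)) := by
  classical
  have h1 : 1 < N := by omega
  have h := sum_nbr_fermiExpectSU_ge_torus hN h3 (NeZero.pos ν) hL.two_dvd hL3 (apSigns ν L) apSigns_eq_or 0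
  simp_rw [fermiExpectSU_meson_eq_ofReal hN h1 hL] at h
  rw [← Complex.ofReal_sum (s := Finset.univ.filter fun b => (torusLinks ν L b).1 = 0 ∨ (torusLinks ν L b).2 = 0)
    (f := fun b => suTwoPoint N ν L (torusLinks ν L b).1 (torusLinks ν L b).2)] at h
  have h' : 4 * (N : ℝ) ≤ ∑ b ∈ Finset.univ.filter (fun b => (torusLinks ν L b).1 = 0 ∨ (torusLinks ν L b).2 = 0),
      suTwoPoint N ν L (torusLinks ν L b).1 (torusLinks ν L b).2 := by exact_mod_cast h
  refine h'.trans (le_of_eq ?_)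
  -- the links at `0`: `(0, μ)` and `(−e_μ, μ)`
  have hne : ∀ μ : Fin ν, (0 : TorusSite ν L) ≠ -Pi.single μ 1 := fun μ h0 => by
    have := congrFun h0 μ
    rw [Pi.zero_apply, Pi.neg_apply, Pi.single_eq_same, eq_comm, neg_eq_zero] at this
    exact absurd this (by
      haveI : Fact (1 < L) := ⟨by omega⟩
      exact one_ne_zero)
  rw [Finset.sum_filter, Fintype.sum_prod_type, Finset.sum_comm]
  refine Finset.sum_congr rfl fun μ _ => ?_
  dsimp only [torusLinks]
  have hset : ∀ y : TorusSite ν L, (y = 0 ∨ y + Pi.single μ 1 = 0) ↔ y ∈ ({0, -Pi.single μ 1} : Finset (TorusSite ν L)) := by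
    intro y
    rw [Finset.mem_insert, Finset.mem_singleton, ← eq_neg_iff_add_eq_zero]
  simp_rw [hset]
  rw [Finset.sum_ite_mem, Finset.univ_inter, Finset.sum_pair (hne μ), zero_add, neg_add_cancel,
    suTwoPoint_comm (-Pi.single μ 1) 0]

/-! ### Chiral long-range order at `β = 0` for `SU(N)`, `N` odd `≥ 3`, `ν ≥ 4` -/

/-- **CHIRAL LONG-RANGE ORDER FOR `SU(N)` LATTICE GAUGE THEORY (`N` ODD `≥ 3`) WITH ONE MASSLESS STAGGERED
FERMION AT `β = 0`, IN EVERY DIMENSION `ν ≥ 4`, UNIFORMLY IN THE VOLUME**: there are `c > 0` and `L₀` with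
`|Λ|⁻¹ ∑_x ⟨ψ̄ψ(0) ψ̄ψ(x)⟩_Λ ≥ c` for all even `L ≥ L₀` (all-antiperiodic torus `(ℤ/Lℤ)^ν`, any ordering of
the Grassmann generators).  Inputs: the infrared bound `infraredBound_SU` (reflection positivity of the
twisted fermion–gauge system with the all-colour hermitian-square certificate, Gaussian domination for the
meson weight, lattice symmetries of the `SU(N)` moments), the Schwinger–Dyson bound
`sum_nbr_fermiExpectSU_ge_torus` (`b = 4N`: the `N`-fold dimers dominate the baryon loops), the chiral
grading, and Salmhofer–Seiler's lattice lemma `kernel_chiralLRO_uniform` with `2·4N·S(ν) < 4N`, i.e.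
`S(ν) < 1/2` (`fluctS_lt_of_four_le`: `S(ν) < 7/20` for `ν ≥ 4`).  This is the `SU(N)` extension named as
«generally believed» in Salmhofer–Seiler §5 p. 424, at `β = 0`.  Honest framing: `β = 0` only; finite volume
uniformly in `L`; nothing about `β > 0`, `SU(2)` (false there), the thermodynamic or continuum limit, several
flavours, or the summit's `QCD` conjunct. [cite: SalmhoferSeiler1991, Thm. 4.8, Cor. 4.9 with (4.41)–(4.42) and §5 p. 424] [cite: FrommForcrand2008, (4)–(7)] -/
theorem chiralLRO_SU (hN : Odd N) (h3 : 3 ≤ N) (hν : 4 ≤ ν) :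
    ∃ c : ℝ, 0 < c ∧ ∃ L₀ : ℕ, ∀ (L : ℕ) [NeZero L] [LinearOrder (TorusSite ν L)], Even L → L₀ ≤ L →
      c ≤ suChiralOrder N ν L := by
  have hν3 : 3 ≤ ν := by omega
  have hν1 : 1 ≤ ν := by omega
  have h1 : 1 < N := by omega
  have hA : (0 : ℝ) ≤ 4 * N := by positivity
  have hS := fluctS_lt_of_four_le hν
  have hNpos : (0 : ℝ) < N := by exact_mod_cast (by omega : 0 < N)
  have hAb : 2 * (4 * (N : ℝ)) * fluctS ν < 4 * N := by nlinarith
  obtain ⟨c, hc, L₁, hL₁⟩ := ComplexSpin.kernel_chiralLRO_uniform (ν := ν) hν3 hA hAb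
  refine ⟨c, hc, max L₁ 3, fun L _ _ hE hLe => ?_⟩
  have hL3 : 3 ≤ L := le_of_max_le_right hLe
  have h := hL₁ L hE (le_of_max_le_left hLe) (fun x y => suTwoPoint N ν L x y)
    (fun x y a => suTwoPoint_add hN h1 hE x y a) (fun x y => suTwoPoint_comm x y)
    (fun z hz => by
      refine suTwoPoint_eq_zero_of_sgn_eq hE ?_
      rw [ComplexSpin.sgn_zero]
      unfold ComplexSpin.sgn
      rw [if_pos hz])
    (fun χ _ _ => infraredBound_SU hN h1 hE (fun c m => mesonMomentSU_mapDomain_addRight hN h1 hE c m)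
      (fun i m => mesonMomentSU_mapDomain_axisSwap hN h1 hE i m) χ)
    (sum_suTwoPoint_nbr_ge hN h3 hE hL3)
  unfold suChiralOrder
  exact h

/-- **The same for `SU(3)`** — one massless staggered quark flavour at infinite gauge coupling has chiral
long-range order in every dimension `ν ≥ 4`, uniformly in the (even, all-antiperiodic) volume. [cite: SalmhoferSeiler1991, §5 p. 424] -/
theorem chiralLRO_SU_three (hν : 4 ≤ ν) :
    ∃ c : ℝ, 0 < c ∧ ∃ L₀ : ℕ, ∀ (L : ℕ) [NeZero L] [LinearOrder (TorusSite ν L)], Even L → L₀ ≤ L →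
      c ≤ suChiralOrder 3 ν L :=
  chiralLRO_SU (by decide) le_rfl hν

end MesonWeightSU

end Summit.Ventures.YMGap.Conjectures

end
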